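import Summits.QuantumFields.YangMills.Theorems.SwapVirialDeficitSectorLaplaceTipCornerConcrete
import Summits.QuantumFields.YangMills.Theorems.SwapVirialDeficitSectorLaplaceTipMidShellIntegrationIso
import Summits.QuantumFields.YangMills.Theorems.SwapVirialDeficitSectorLaplaceMbDensityComparableRescaled
import HarnessLib

/-!
# THE TIP OF SKELETON ➎, THE MID BOX AGAINST THE BULK MAIN TERM — concrete composition
# (cell ym-idea-1; free-hands support of ⟨stmt-QuantumFields-24197⟩ `SwapVirialDeficit.SwapGluedStiffness`; LEAD g99 ruling (R1) 2026-09-01 01:07Z «MID on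
# Box = {|p| ≥ ρ₀} by w2 g61's ✓`mbDensity_hubAt_comparable_rescaled` → w3 g68's ✓`tipMid_le_shell_of_pointwise′` → ✓`shell_boxMass_le_mbMain`»)

★★ `tipMidBox_le_mbMain` — for good `ε`, `0 < τ ≤ (1 + 16·δr²)⁻¹` (matching letter `δr(L)` of ✓`cornerWindow_facts`, shell `[δr, 2δr]`), `0 < ρ₀`, and any measurable
`Mid ⊆ Ioi √(τ⁻¹−1)`: `coneConst·π·∫_{Mid}((1+δ²)⁻¹)²·∫_{ρ₀² ≤ |p|²}𝔪(hubAt δ 1) ≤ R₁(L,ρ₀)/(√(τ⁻¹−1)·W′)·M_ε`,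
`R₁ = R₀·(2(1+ρ₀²)/ρ₀²)` (w2's constant), `W′ = (c/(1+c²) − a/(1+a²) + (arctan c − arctan a))/2` at `a = δr`, `c = 2δr` — a `√τ·ρ₀⁻²`-rate.

HONEST LABEL: composition bookkeeping; `stub_core_tip` (core ceiling, glue), ⟨24197⟩ ∕ ⟨24194⟩ OPEN; item of record ⟨24085⟩ `SubOctaveBounded` aside ∕ untouched; the
Yang–Mills mass gap is NOT proved; no summit is proved by a line.  THEOREMS ONLY (0 `def`, 0 `sorry`), standard axioms, no instances.  Seat ym-line-fcl-p3 g49 (cell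
ym-idea-1, free hands = ➎ assembler), `--supports stmt-QuantumFields-24197`.  References: [cite: Luscher1983, §2]; [folklore].
-/

set_option autoImplicit false
set_option synthInstance.maxSize 1024

noncomputable section

open MeasureTheory Quaternion Set Module
open scoped Quaternion BigOperators ENNReal
open Literature.MathematicalPhysics.QuantumLattice
open Literature.MathematicalPhysics.QuantumFieldTheory hiding SU2
open Summit.QuantumFields.YangMills.Theorems.SwapTwistDeficit.ToronLog

namespace Summit.QuantumFields.YangMills.Theorems.SwapVirialDeficit.SectorLaplace

open Summit.QuantumFields.YangMills.Theorems.FemtoTransferGap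
open Summit.QuantumFields.YangMills.Theorems.FemtoTransferGap.TT
open Summit.QuantumFields.YangMills.Theorems.VirialFluxGap.RingDeficit
open Summit.QuantumFields.YangMills.Theorems.SwapVirialDeficit.SwapRing
open Summit.QuantumFields.YangMills.Theorems.SwapVirialDeficit.BlowUpRing

variable {L : ℕ} [NeZero L]

set_option maxHeartbeats 800000 in
/-- ★★ **THE MID BOX OF THE TIP WEIGHS A `√τ·ρ₀⁻²`-RATE OF THE BULK MAIN TERM**: for good `ε`, `0 < τ ≤ (1 + 16·δr²)⁻¹`, `0 < ρ₀`, any measurable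
`Mid ⊆ Ioi √(τ⁻¹ − 1)`: `coneConst·π·∫_{Mid}((1+δ²)⁻¹)²·∫_{ρ₀² ≤ |p|²}𝔪(hubAt δ 1) ≤ R₁/(√(τ⁻¹−1)·W′)·M_ε` (w2 g61 ✓`mbDensity_hubAt_comparable_rescaled`,
w3 g68 ✓`tipMid_le_shell_of_pointwise'` and ✓`shell_boxMass_le_mbMain`). [cite: Luscher1983, §2] -/
theorem tipMidBox_le_mbMain {ε : GnoSign L} (hε : GoodSign ε) {τ : ℝ} (hτ : 0 < τ)
    (hτw : τ ≤ (1 + 16 * (12 * 122689728 * 2304 * (Fintype.card (Fol L) : ℝ) ^ 2 * (L : ℝ) ^ 10) ^ 2)⁻¹)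
    {ρ₀ : ℝ} (hρ₀ : 0 < ρ₀) {Mid : Set ℝ} (hMid : MeasurableSet Mid) (hMid₁ : Mid ⊆ Ioi (Real.sqrt (τ⁻¹ - 1))) :
    coneConst * Real.pi * ∫ δ in Mid, ((1 + δ ^ 2)⁻¹) ^ 2 * ∫ p in {p : ℝ × ℝ | ρ₀ ^ 2 ≤ p.1 ^ 2 + p.2 ^ 2}, mbDensity (L := L) (hubAt δ 1) ε p ≤
      (Real.exp 1 * ((1 + (finrank ℝ (GnoFol L) : ℝ)) * (20400 * (L : ℝ) ^ 4)) ^ (7 / 2 : ℝ) *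
            (Real.sqrt ((1 / 4 : ℝ) * (1 / (1800 * (L : ℝ) ^ 6))) ^ 3)⁻¹ * ((1800 * (L : ℝ) ^ 6) ^ 2 * (2 * ((1 + ρ₀ ^ 2) / ρ₀ ^ 2)))) /
          (Real.sqrt (τ⁻¹ - 1) *
            (((2 * (12 * 122689728 * 2304 * (Fintype.card (Fol L) : ℝ) ^ 2 * (L : ℝ) ^ 10)) /
                  (1 + (2 * (12 * 122689728 * 2304 * (Fintype.card (Fol L) : ℝ) ^ 2 * (L : ℝ) ^ 10)) ^ 2) -
                (12 * 122689728 * 2304 * (Fintype.card (Fol L) : ℝ) ^ 2 * (L : ℝ) ^ 10) /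
                  (1 + (12 * 122689728 * 2304 * (Fintype.card (Fol L) : ℝ) ^ 2 * (L : ℝ) ^ 10) ^ 2) +
              (Real.arctan (2 * (12 * 122689728 * 2304 * (Fintype.card (Fol L) : ℝ) ^ 2 * (L : ℝ) ^ 10)) -
                Real.arctan (12 * 122689728 * 2304 * (Fintype.card (Fol L) : ℝ) ^ 2 * (L : ℝ) ^ 10))) / 2)) *
        ∫ a in HubBulk τ, (∫ p : ℝ × ℝ, mbDensity (L := L) a ε p) ∂coneMeasure := by
  obtain ⟨hδr1, -, -, hwin1, -⟩ := cornerWindow_facts (L := L)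
  set n : ℝ := (Fintype.card (Fol L) : ℝ) with hn
  set δr : ℝ := 12 * 122689728 * 2304 * n ^ 2 * (L : ℝ) ^ 10 with hδr
  set R₁ : ℝ := Real.exp 1 * ((1 + (finrank ℝ (GnoFol L) : ℝ)) * (20400 * (L : ℝ) ^ 4)) ^ (7 / 2 : ℝ) *
      (Real.sqrt ((1 / 4 : ℝ) * (1 / (1800 * (L : ℝ) ^ 6))) ^ 3)⁻¹ * ((1800 * (L : ℝ) ^ 6) ^ 2 * (2 * ((1 + ρ₀ ^ 2) / ρ₀ ^ 2))) with hR₁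
  set μ : ℝ := (2304 * (L : ℝ) ^ 6 * n)⁻¹ with hμ
  set δ₁ : ℝ := Real.sqrt (τ⁻¹ - 1) with hδ₁
  set Box : Set (ℝ × ℝ) := {p : ℝ × ℝ | ρ₀ ^ 2 ≤ p.1 ^ 2 + p.2 ^ 2} with hBoxdef
  have hcc : 0 < coneConst * Real.pi := mul_pos coneConst_pos Real.pi_pos
  have hL1 : (1 : ℝ) ≤ L := by exact_mod_cast NeZero.one_le
  have hR₁0 : 0 < R₁ := by
    rw [hR₁]
    have h1 : 0 < Real.sqrt ((1 / 4 : ℝ) * (1 / (1800 * (L : ℝ) ^ 6))) := Real.sqrt_pos.2 (by positivity)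
    have h2 : 0 < (1 + ρ₀ ^ 2) / ρ₀ ^ 2 := div_pos (by positivity) (pow_pos hρ₀ 2)
    have h3 : 0 < ((1 + (finrank ℝ (GnoFol L) : ℝ)) * (20400 * (L : ℝ) ^ 4)) ^ (7 / 2 : ℝ) := Real.rpow_pos_of_pos (by positivity) _
    exact mul_pos (mul_pos (mul_pos (Real.exp_pos 1) h3) (inv_pos.2 (pow_pos h1 3))) (mul_pos (by positivity) (mul_pos two_pos h2))
  have hδr0 : 0 < δr := by linarith
  have hμ0 : 0 < μ := by rw [hμ]; have := (folMu_pos_le (L := L)).1; exact this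
  have hn0 : 0 < n := by
    have h : (1 : ℝ) ≤ n := by rw [hn]; exact_mod_cast one_le_card_fol (L := L)
    linarith
  -- the window
  have hτ1 : τ ≤ 1 := hτw.trans (inv_le_one_of_one_le₀ (le_add_of_nonneg_right (by positivity)))
  have hc2 : (2 * δr) ^ 2 ≤ τ⁻¹ - 1 := by
    have h1 : 1 + 16 * δr ^ 2 ≤ τ⁻¹ := by rw [le_inv_comm₀ (by positivity) hτ]; exact hτw
    have e : (2 * δr) ^ 2 = 4 * δr ^ 2 := by ring
    rw [e]; linarith [sq_nonneg δr]
  have hδ₁c : 2 * δr ≤ δ₁ := by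
    rw [hδ₁, ← Real.sqrt_sq (by positivity : (0:ℝ) ≤ 2 * δr)]; exact Real.sqrt_le_sqrt hc2
  have hδ₁0 : 0 < δ₁ := lt_of_lt_of_le (by positivity) hδ₁c
  have hshell : Icc δr (2 * δr) ⊆ {δ : ℝ | τ ≤ 4 * δ ^ 2 / (1 + δ ^ 2) ^ 2 ∧ τ ≤ (1 + δ ^ 2)⁻¹} := Icc_subset_bulkWindow hτ hδr1 hc2
  have hBox : MeasurableSet Box := by rw [hBoxdef]; exact measurableSet_le measurable_const (by fun_prop)
  -- the matching window for δr alone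
  have hwin : 122689728 * δr⁻¹ * (L : ℝ) ^ 4 ≤ μ / (2 * (3 * n)) := by
    rw [hwin1]; exact div_le_self (by positivity) (by norm_num)
  -- (H′) on the box
  have H : ∀ δt ∈ Mid, ∀ δs ∈ Icc δr (2 * δr), δs ≤ δt → ∀ p ∈ Box,
      mbDensity (L := L) (hubAt δt 1) ε p ≤ R₁ * (1 + δt ^ 2) * mbDensity (L := L) (hubAt δs 1) ε p := by
    intro δt hδt δs hδs hst p hp
    have h := mbDensity_hubAt_comparable_rescaled (L := L) hε hδr1 hδs.1 (hδs.1.trans hst) hwin hρ₀ p hp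
    rw [← hR₁] at h
    exact h
  have hInt : ∀ δs ∈ Icc δr (2 * δr), IntegrableOn (fun p : ℝ × ℝ => mbDensity (L := L) (hubAt δs 1) ε p) Box :=
    fun δs hδs => (integrable_mbDensity_hubAt_of_window hε hτ hτ1 (hshell hδs)).integrableOn
  have hS : IntegrableOn (fun δ : ℝ => ((1 + δ ^ 2)⁻¹) ^ 2 * ∫ p in Box, mbDensity (L := L) (hubAt δ 1) ε p) (Icc δr (2 * δr)) :=
    (integrableOn_sqInv_mul_boxMass hε hτ hτ1 Box).mono_set hshell
  have hlayer := tipMid_le_shell_of_pointwise' (L := L) ε hMid hMid₁ hδr1 (by linarith : δr < 2 * δr) hδ₁c hBox hR₁0.le H hInt hS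
  have hshellMain := shell_boxMass_le_mbMain (L := L) hε hτ hτ1 hδr1 hc2 Box
  -- the shell weight `W′ > 0`
  have hW : 0 < ((2 * δr) / (1 + (2 * δr) ^ 2) - δr / (1 + δr ^ 2) + (Real.arctan (2 * δr) - Real.arctan δr)) / 2 := by
    have h := integral_Icc_inv_one_add_sq_sq_ge hδr1 (by linarith : δr ≤ 2 * δr)
    rw [integral_Icc_inv_one_add_sq_sq (by linarith : δr ≤ 2 * δr)] at h
    have hlt : (2 * δr)⁻¹ ^ 3 < δr⁻¹ ^ 3 := by
      have h1 : (2 * δr)⁻¹ < δr⁻¹ := by rw [inv_lt_inv₀ (by positivity) hδr0]; linarith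
      exact pow_lt_pow_left₀ h1 (by positivity) (by norm_num)
    linarith
  have hpre0 : 0 ≤ R₁ / (δ₁ * (((2 * δr) / (1 + (2 * δr) ^ 2) - δr / (1 + δr ^ 2) + (Real.arctan (2 * δr) - Real.arctan δr)) / 2)) := by positivity
  calc coneConst * Real.pi * ∫ δ in Mid, ((1 + δ ^ 2)⁻¹) ^ 2 * ∫ p in Box, mbDensity (L := L) (hubAt δ 1) ε p
      ≤ coneConst * Real.pi * (R₁ / (δ₁ * (((2 * δr) / (1 + (2 * δr) ^ 2) - δr / (1 + δr ^ 2) + (Real.arctan (2 * δr) - Real.arctan δr)) / 2)) *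
          ∫ δ in Icc δr (2 * δr), ((1 + δ ^ 2)⁻¹) ^ 2 * ∫ p in Box, mbDensity (L := L) (hubAt δ 1) ε p) := mul_le_mul_of_nonneg_left hlayer hcc.le
    _ = R₁ / (δ₁ * (((2 * δr) / (1 + (2 * δr) ^ 2) - δr / (1 + δr ^ 2) + (Real.arctan (2 * δr) - Real.arctan δr)) / 2)) *
          (coneConst * Real.pi * ∫ δ in Icc δr (2 * δr), ((1 + δ ^ 2)⁻¹) ^ 2 * ∫ p in Box, mbDensity (L := L) (hubAt δ 1) ε p) := by ring
    _ ≤ R₁ / (δ₁ * (((2 * δr) / (1 + (2 * δr) ^ 2) - δr / (1 + δr ^ 2) + (Real.arctan (2 * δr) - Real.arctan δr)) / 2)) *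
          ∫ a in HubBulk τ, (∫ p : ℝ × ℝ, mbDensity (L := L) a ε p) ∂coneMeasure := mul_le_mul_of_nonneg_left hshellMain hpre0

end Summit.QuantumFields.YangMills.Theorems.SwapVirialDeficit.SectorLaplace

end
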